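import Mathlib.Analysis.Calculus.Deriv.Star
import Mathlib.Analysis.InnerProductSpace.Calculus
import Mathlib.Analysis.Calculus.MeanValue
import Mathlib.Analysis.SpecialFunctions.Pow.Asymptotics
import Mathlib.Analysis.Complex.RealDeriv
import Literature.Analysis.Complex.LogDerivZeros
import HarnessLib

/-!
# Laguerre–Pólya monotonicity and de Bruijn's shift operator, without Hadamard factorisation

Trunk T-ANALYSIS support (`Literature/Analysis/Complex`), serving the discharge of de Bruijn's
monotonicity theorem `Literature.NumberTheory.LFunctions.HasOnlyRealZeros.mono_deBruijnH`
(`Literature/NumberTheory/LFunctions/DeBruijnNewman.lean`; de Bruijn 1950, Thm. 13).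

Let `f` be a *real entire function of order `< 2` with only real zeros*: `f` entire,
`‖f(z)‖ ≤ C e^{‖z‖^ρ}` for some `0 ≤ ρ < 2`, `f(ℝ) ⊆ ℝ`, and `f(z) = 0 ⇒ z ∈ ℝ`. Classically
(Laguerre, Pólya) such `f` has the Hadamard product `c zᵐ e^{αz} ∏ (1 − z/aₖ) e^{z/aₖ}` and hence
`Im (f'/f)(z) = −(Im z) ∑ mₖ/|z − aₖ|² ≤ 0` on the upper half-plane, so that `|f(x + iy)|`
increases with `|y|`. We prove these two facts *without* any factorisation theorem, from
Titchmarsh's Lemma α (`Literature.Analysis.Complex.titchmarsh_logDeriv_sub_sum`): on `|z − c| < R`,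
`f'/f = ∑_{|a−c|≤R} m(a)/(z − a) + ψ_R` with `|ψ_R'| ≪ R^{ρ−2} → 0`, and `ψ_R(c) ∈ ℝ` for real
`c`, so `Im ψ_R(z) → 0` as `R → ∞`.

## Contents (all proved)

* `Literature.Analysis.Complex.apply_conj_eq_conj`: Schwarz reflection `f(z̄) = conj f(z)` for entire `f` real on `ℝ`.
* `Literature.Analysis.Complex.im_mul_im_logDeriv_le`, `Literature.Analysis.Complex.im_mul_im_logDeriv_nonpos`:
  `(Im z) · Im (f'/f)(z) ≤ −(Im z)²/|z − a|²` for every zero `a`, and `≤ 0`.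
* `Literature.Analysis.Complex.im_logDeriv_eq_zero_of_forall_ne_zero`: a zero-free such `f` has `Im (f'/f) ≡ 0`.
* `Literature.Analysis.Complex.hasDerivAt_norm_sq_vertical`, `Literature.Analysis.Complex.monotoneOn_norm_sq_vertical`,
  `Literature.Analysis.Complex.strictMonoOn_norm_sq_vertical`: `y ↦ |f(x + iy)|²` has derivative
  `−2 |f|² Im (f'/f)` and is (strictly, if `f` has a zero) increasing on `[0, ∞)`.
* `Literature.Analysis.Complex.deBruijn_shift_dichotomy` — **de Bruijn 1950, Thm. 8 with `Δ = 0`, `N = 1`**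
  (the entire-function form of his Lemma 1/Thm. 3): `f(z + iλ) + f(z − iλ)` is either `≡ 0` or
  has only real zeros; it is again real entire of order `< 2`
  (`differentiable_shift`, `im_shift_ofReal`, `norm_shift_le`).
* `Literature.Analysis.Complex.deBruijn_iterate_shift_dichotomy` — **de Bruijn 1950, Thm. 8 with `Δ = 0`,
  `φ(u) = (1 + u)^M`**: the `M`-fold iterate `∑ₖ (M choose k) f(z + (2k − M)iλ)` is `≡ 0` or has
  only real zeros.

## References

* N. G. de Bruijn, *The roots of trigonometric integrals*, Duke Math. J. 17 (1950), 197–226,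
  Lemma 1, Thms. 3, 6, 8 (§§2–3).
* E. C. Titchmarsh, *The theory of the Riemann zeta-function*, 2nd ed., Oxford 1986, §3.9 Lemma α.
* B. Ja. Levin, *Distribution of zeros of entire functions*, AMS 1964, Ch. VIII (Laguerre–Pólya class).
-/

noncomputable section

open Complex Filter Metric Set Topology
open scoped ComplexConjugate

namespace Literature.Analysis.Complex

variable {f : ℂ → ℂ}

/-! ## Real entire functions: Schwarz reflection and real derivatives -/

/-- The punctured real neighbourhoods of `0` map into the punctured complex ones. [folklore] -/
theorem tendsto_ofReal_nhdsNE_zero :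
    Tendsto (fun x : ℝ ↦ (x : ℂ)) (𝓝[≠] 0) (𝓝[≠] 0) := by
  refine tendsto_nhdsWithin_iff.2 ⟨?_, ?_⟩
  · have h := (Complex.continuous_ofReal.tendsto (0 : ℝ)).mono_left
      (nhdsWithin_le_nhds (s := {(0 : ℝ)}ᶜ))
    simpa using h
  · filter_upwards [self_mem_nhdsWithin] with x hx
    simpa using hx

/-- An entire function vanishing on `ℝ` vanishes identically. [folklore] -/
theorem eq_zero_of_forall_ofReal_eq_zero (hf : Differentiable ℂ f) (h : ∀ x : ℝ, f x = 0)
    (z : ℂ) : f z = 0 := by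
  have hfreq : ∃ᶠ w in 𝓝[≠] (0 : ℂ), f w = 0 :=
    tendsto_ofReal_nhdsNE_zero.frequently (Eventually.of_forall h).frequently
  exact (hf.differentiableOn.analyticOnNhd isOpen_univ).eqOn_zero_of_preconnected_of_frequently_eq_zero
    isPreconnected_univ (mem_univ 0) hfreq (mem_univ z)

/-- An entire function `f ≢ 0` does not vanish at some real point. [folklore] -/
theorem exists_ofReal_ne_zero (hf : Differentiable ℂ f) (h0 : ∃ z, f z ≠ 0) : ∃ c : ℝ, f c ≠ 0 := by
  by_contra h
  push Not at h
  obtain ⟨z, hz⟩ := h0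
  exact hz (eq_zero_of_forall_ofReal_eq_zero hf h z)

/-- **Schwarz reflection** for an entire function real on the real axis: `f(z̄) = (f z)^*`
(identity theorem for `z ↦ (f(z̄))^*`, which is entire and agrees with `f` on `ℝ`). [folklore] -/
theorem apply_conj_eq_conj (hf : Differentiable ℂ f) (hreal : ∀ x : ℝ, (f x).im = 0) (z : ℂ) :
    f (conj z) = conj (f z) := by
  set g : ℂ → ℂ := conj ∘ f ∘ conj with hg
  have hgd : Differentiable ℂ g := fun w ↦ differentiableAt_conj_conj_iff.2 (hf (conj w))
  have hgf : ∀ x : ℝ, g x = f x := fun x ↦ by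
    simp only [hg, Function.comp_apply, Complex.conj_ofReal]
    exact Complex.conj_eq_iff_im.2 (hreal x)
  have hfreq : ∃ᶠ w in 𝓝[≠] (0 : ℂ), g w = f w :=
    tendsto_ofReal_nhdsNE_zero.frequently (Eventually.of_forall hgf).frequently
  have heq : EqOn g f univ :=
    (hgd.differentiableOn.analyticOnNhd isOpen_univ).eqOn_of_preconnected_of_frequently_eq
      (hf.differentiableOn.analyticOnNhd isOpen_univ) isPreconnected_univ (mem_univ 0) hfreq
  have h1 : g (conj z) = f (conj z) := heq (mem_univ _)
  simp only [hg, Function.comp_apply, Complex.conj_conj] at h1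
  exact h1.symm

/-- `‖f(z̄)‖ = ‖f(z)‖` for `f` entire and real on `ℝ`. [folklore] -/
theorem norm_apply_conj (hf : Differentiable ℂ f) (hreal : ∀ x : ℝ, (f x).im = 0) (z : ℂ) :
    ‖f (conj z)‖ = ‖f z‖ := by
  rw [apply_conj_eq_conj hf hreal, Complex.norm_conj]

/-- On a vertical line the modulus only depends on `|y|`: `‖f(x + iy)‖ = ‖f(x + i|y|)‖`.
[folklore] -/
theorem norm_vertical_eq_abs (hf : Differentiable ℂ f) (hreal : ∀ x : ℝ, (f x).im = 0)
    (x y : ℝ) : ‖f (x + I * y)‖ = ‖f (x + I * |y|)‖ := by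
  rcases le_or_gt 0 y with hy | hy
  · rw [abs_of_nonneg hy]
  · rw [abs_of_neg hy, ← norm_apply_conj hf hreal]
    congr 2
    apply Complex.ext <;> simp

/-- The derivative of a real entire function is real on the real axis. [folklore] -/
theorem im_deriv_ofReal (hf : Differentiable ℂ f) (hreal : ∀ x : ℝ, (f x).im = 0) (x : ℝ) :
    (deriv f x).im = 0 := by
  have h1 : HasDerivAt f (deriv f x) x := (hf x).hasDerivAt
  have h2 : HasDerivAt (conj ∘ f ∘ conj) (conj (deriv f x)) (conj (x : ℂ)) := h1.conj_conj
  have h3 : (conj ∘ f ∘ conj) = f := by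
    funext w
    simp [Function.comp_apply, apply_conj_eq_conj hf hreal]
  rw [h3, Complex.conj_ofReal] at h2
  exact Complex.conj_eq_iff_im.1 (h1.unique h2).symm

/-- A function with only real zeros in the sense `f z = 0 → Im z = 0` is not identically zero.
[folklore] -/
theorem apply_I_ne_zero (hzero : ∀ z, f z = 0 → z.im = 0) : f I ≠ 0 := fun h ↦ by
  simpa using hzero I h

/-! ## Elementary facts about the growth bound -/

/-- The constant in a growth bound `‖f z‖ ≤ C e^{‖z‖^ρ}` is `≥ 0`. [folklore] -/
theorem growthConst_nonneg {ρ C : ℝ} (hgr : ∀ z, ‖f z‖ ≤ C * Real.exp (‖z‖ ^ ρ)) : 0 ≤ C := by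
  have h := (norm_nonneg _).trans (hgr 0)
  exact (mul_nonneg_iff_of_pos_right (Real.exp_pos _)).1 h

/-- The constant is `> 0` as soon as `f ≢ 0`. [folklore] -/
theorem growthConst_pos {ρ C : ℝ} (hgr : ∀ z, ‖f z‖ ≤ C * Real.exp (‖z‖ ^ ρ)) {w : ℂ}
    (hw : f w ≠ 0) : 0 < C := by
  have h := (norm_pos_iff.2 hw).trans_le (hgr w)
  exact (mul_pos_iff_of_pos_right (Real.exp_pos _)).1 h

/-- The bound on a closed ball around a real centre: `‖f‖ ≤ C e^{(|c| + 2R)^ρ}` on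
`‖z − c‖ ≤ 2R` (`ρ ≥ 0`). [folklore] -/
theorem norm_le_on_closedBall {ρ C : ℝ} (hρ0 : 0 ≤ ρ)
    (hgr : ∀ z, ‖f z‖ ≤ C * Real.exp (‖z‖ ^ ρ)) (c R : ℝ) :
    ∀ z ∈ closedBall (c : ℂ) (2 * R), ‖f z‖ ≤ C * Real.exp ((|c| + 2 * R) ^ ρ) := by
  intro z hz
  have hC := growthConst_nonneg hgr
  refine (hgr z).trans (mul_le_mul_of_nonneg_left (Real.exp_le_exp.2
    (Real.rpow_le_rpow (norm_nonneg _) ?_ hρ0)) hC)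
  calc ‖z‖ = ‖(z - c) + c‖ := by ring_nf
    _ ≤ ‖z - c‖ + ‖(c : ℂ)‖ := norm_add_le _ _
    _ ≤ 2 * R + |c| := by
        rw [Complex.norm_real, Real.norm_eq_abs]
        exact add_le_add (mem_closedBall_iff_norm.1 hz) le_rfl
    _ = |c| + 2 * R := add_comm _ _

/-- The error term of Titchmarsh's lemma tends to `0`: for `0 ≤ ρ < 2`,
`(K + (|c| + 2R)^ρ)/R² → 0` as `R → ∞`. [folklore] -/
theorem tendsto_growth_div_sq (K c : ℝ) {ρ : ℝ} (hρ0 : 0 ≤ ρ) (hρ : ρ < 2) :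
    Tendsto (fun R : ℝ ↦ (K + (|c| + 2 * R) ^ ρ) / R ^ 2) atTop (𝓝 0) := by
  have h1 : Tendsto (fun R : ℝ ↦ K / R ^ 2) atTop (𝓝 0) :=
    tendsto_const_nhds.div_atTop (tendsto_pow_atTop two_ne_zero)
  have h2 : Tendsto (fun R : ℝ ↦ (|c| + 2 * R) ^ ρ / R ^ 2) atTop (𝓝 0) := by
    have hup : Tendsto (fun R : ℝ ↦ 9 * R ^ (-(2 - ρ))) atTop (𝓝 0) := by
      simpa using (tendsto_rpow_neg_atTop (by linarith : 0 < 2 - ρ)).const_mul 9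
    refine tendsto_of_tendsto_of_tendsto_of_le_of_le' tendsto_const_nhds hup ?_ ?_
    · filter_upwards [eventually_ge_atTop 0] with R hR
      positivity
    · filter_upwards [eventually_ge_atTop (max |c| 1)] with R hR
      have hRc : |c| ≤ R := (le_max_left _ _).trans hR
      have hR1 : 1 ≤ R := (le_max_right _ _).trans hR
      have hR0 : 0 < R := by linarith
      have h3 : (|c| + 2 * R) ^ ρ ≤ (3 * R) ^ ρ :=
        Real.rpow_le_rpow (by positivity) (by linarith) hρ0
      have h4 : (3 * R) ^ ρ = 3 ^ ρ * R ^ ρ := Real.mul_rpow (by norm_num) hR0.le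
      have h5 : (3 : ℝ) ^ ρ ≤ 9 := by
        calc (3 : ℝ) ^ ρ ≤ 3 ^ (2 : ℝ) := Real.rpow_le_rpow_of_exponent_le (by norm_num) hρ.le
          _ = 9 := by norm_num
      have h6 : R ^ (-(2 - ρ)) = R ^ ρ / R ^ 2 := by
        rw [show -(2 - ρ) = ρ - 2 by ring, Real.rpow_sub hR0, Real.rpow_two]
      rw [h6, ← mul_div_assoc]
      apply div_le_div_of_nonneg_right _ (by positivity)
      calc (|c| + 2 * R) ^ ρ ≤ 3 ^ ρ * R ^ ρ := h3.trans h4.le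
        _ ≤ 9 * R ^ ρ := by gcongr
  simpa [add_div] using h1.add h2

/-! ## The imaginary part of the logarithmic derivative -/

/-- **Approximation of `f'/f` by the nearby zeros, with real error at real points.** Let `f`
be entire with `‖f‖ ≤ C e^{‖z‖^ρ}` (`0 ≤ ρ < 2`), real on `ℝ`, with only real zeros, and let
`c ∈ ℝ` with `f(c) ≠ 0`, `f(z) ≠ 0`. For every `r` and `ε > 0` there are finitely many zeros
`S ∋` (all zeros `a` with `|a − c| ≤ r`), multiplicities `m ≥ 1`, and `ψ ∈ ℂ` with
`f'(z)/f(z) = ∑_{a ∈ S} m(a)/(z − a) + ψ` and `|Im ψ| ≤ ε`. (Titchmarsh's Lemma α on `|w − c| < R`,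
`R → ∞`: `ψ_R(c)` is real and `|ψ_R'| ≤ 64((|c|+2R)^ρ + O(1))/R² → 0`.)
[cite: Titchmarsh1986, §3.9 Lemma α] -/
theorem exists_logDeriv_eq_sum_add_small_im (hf : Differentiable ℂ f) {ρ C : ℝ} (hρ0 : 0 ≤ ρ)
    (hρ : ρ < 2) (hgr : ∀ z, ‖f z‖ ≤ C * Real.exp (‖z‖ ^ ρ)) (hreal : ∀ x : ℝ, (f x).im = 0)
    (hzero : ∀ z, f z = 0 → z.im = 0) {c : ℝ} (hc : f c ≠ 0) {z : ℂ} (hz : f z ≠ 0) (r : ℝ)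
    {ε : ℝ} (hε : 0 < ε) :
    ∃ (S : Finset ℂ) (m : ℂ → ℕ) (ψ : ℂ), (∀ a ∈ S, f a = 0 ∧ 0 < m a) ∧
      (∀ a, f a = 0 → ‖a - c‖ ≤ r → a ∈ S) ∧
      deriv f z / f z = ∑ a ∈ S, (m a : ℂ) / (z - a) + ψ ∧ |ψ.im| ≤ ε := by
  classical
  have hCpos : 0 < C := growthConst_pos hgr hc
  have hfc : 0 < ‖f (c : ℂ)‖ := norm_pos_iff.2 hc
  set d : ℝ := ‖z - c‖ with hd
  set K : ℝ := Real.log C - Real.log ‖f (c : ℂ)‖ + 1 with hK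
  -- choose `R`
  have hlim : Tendsto (fun R : ℝ ↦ 64 * ((K + (|c| + 2 * R) ^ ρ) / R ^ 2) * d) atTop (𝓝 0) := by
    simpa using ((tendsto_growth_div_sq K c hρ0 hρ).const_mul 64).mul_const d
  obtain ⟨R, hRε, hRge⟩ := ((hlim.eventually_lt_const hε).and
    (eventually_ge_atTop (max (max |r| 1) (8 * d + 1)))).exists
  have hR1 : 1 ≤ R := ((le_max_right _ _).trans (le_max_left _ _)).trans hRge
  have hRpos : 0 < R := by linarith
  have hRr : r ≤ R := ((le_abs_self r).trans ((le_max_left _ _).trans (le_max_left _ _))).trans hRge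
  have hRd : 8 * d + 1 ≤ R := (le_max_right _ _).trans hRge
  have hd0 : 0 ≤ d := norm_nonneg _
  -- Titchmarsh's lemma on `‖w - c‖ < R`
  set M : ℝ := C * Real.exp ((|c| + 2 * R) ^ ρ) with hM
  obtain ⟨S, m, ψ, hS, hS', hψd, hψeq, -, hψ'⟩ :=
    titchmarsh_logDeriv_sub_sum hf hc hRpos (norm_le_on_closedBall hρ0 hgr c R)
  have hlog : Real.log (M / ‖f (c : ℂ)‖) + 1 = K + (|c| + 2 * R) ^ ρ := by
    rw [hK, hM, Real.log_div (by positivity) hfc.ne', Real.log_mul hCpos.ne' (Real.exp_pos _).ne',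
      Real.log_exp]
    ring
  -- `ψ c` is real
  have hcball : (c : ℂ) ∈ ball (c : ℂ) R := mem_ball_self hRpos
  have hzball : z ∈ ball (c : ℂ) R := mem_ball_iff_norm.2 (by rw [← hd]; linarith)
  have hψc : (ψ c).im = 0 := by
    rw [hψeq _ hcball hc, Complex.sub_im, Complex.im_sum]
    have h1 : (deriv f c / f c).im = 0 := by
      have e1 : deriv f c = ((deriv f c).re : ℂ) :=
        Complex.ext (by simp) (by simp [im_deriv_ofReal hf hreal c])
      have e2 : f c = ((f c).re : ℂ) := Complex.ext (by simp) (by simp [hreal c])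
      rw [e1, e2, ← Complex.ofReal_div, Complex.ofReal_im]
    have h2 : ∀ a ∈ S, ((m a : ℂ) / (c - a)).im = 0 := by
      intro a ha
      have har : a = ((a.re : ℝ) : ℂ) := Complex.ext (by simp) (by simp [hzero a (hS a ha).1])
      rw [har, ← Complex.ofReal_sub, ← Complex.ofReal_natCast, ← Complex.ofReal_div,
        Complex.ofReal_im]
    rw [h1, Finset.sum_eq_zero h2, sub_zero]
  -- mean value estimate on the convex set `closedBall c (R/8)`
  have hsub : closedBall (c : ℂ) (R / 8) ⊆ ball (c : ℂ) R := closedBall_subset_ball (by linarith)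
  have hmv : ‖ψ z - ψ c‖ ≤ 64 * (Real.log (M / ‖f (c : ℂ)‖) + 1) / R ^ 2 * ‖z - c‖ := by
    refine (convex_closedBall (c : ℂ) (R / 8)).norm_image_sub_le_of_norm_deriv_le
      (fun w hw ↦ hψd.differentiableAt (isOpen_ball.mem_nhds (hsub hw))) (fun w hw ↦ hψ' w hw)
      (mem_closedBall_self (by linarith)) (mem_closedBall_iff_norm.2 ?_)
    rw [← hd]; linarith
  refine ⟨S, m, ψ z, fun a ha ↦ ⟨(hS a ha).1, (hS a ha).2.1⟩,
    fun a ha har ↦ hS' a ha (har.trans hRr), ?_, ?_⟩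
  · rw [hψeq z hzball hz]; ring
  · have h1 : |(ψ z).im| = |(ψ z - ψ c).im| := by rw [Complex.sub_im, hψc, sub_zero]
    rw [h1]
    calc |(ψ z - ψ c).im| ≤ ‖ψ z - ψ c‖ := Complex.abs_im_le_norm _
      _ ≤ 64 * (Real.log (M / ‖f (c : ℂ)‖) + 1) / R ^ 2 * ‖z - c‖ := hmv
      _ = 64 * ((K + (|c| + 2 * R) ^ ρ) / R ^ 2) * d := by rw [hlog, hd]; ring
      _ ≤ ε := hRε.le

/-- The imaginary part of one term: for a real zero `a`,
`(Im z) · Im (m/(z − a)) = −m (Im z)²/‖z − a‖²`. [folklore] -/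
theorem im_mul_im_div_sub {a : ℂ} (ha : a.im = 0) (m : ℕ) (z : ℂ) :
    z.im * ((m : ℂ) / (z - a)).im = -(m * z.im ^ 2 / ‖z - a‖ ^ 2) := by
  rw [Complex.div_im, ← Complex.normSq_eq_norm_sq]
  simp [ha]
  ring

/-- **`Im (f'/f)` has the sign of `−Im z`, quantitatively.** For `f` real entire of order `< 2`
with only real zeros and any zero `a` of `f`:
`(Im z) · Im (f'(z)/f(z)) ≤ −(Im z)²/‖z − a‖²` (`Im z ≠ 0`). [folklore] -/
theorem im_mul_im_logDeriv_le (hf : Differentiable ℂ f) {ρ C : ℝ} (hρ0 : 0 ≤ ρ) (hρ : ρ < 2)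
    (hgr : ∀ z, ‖f z‖ ≤ C * Real.exp (‖z‖ ^ ρ)) (hreal : ∀ x : ℝ, (f x).im = 0)
    (hzero : ∀ z, f z = 0 → z.im = 0) {z : ℂ} (hz : z.im ≠ 0) {a : ℂ} (ha : f a = 0) :
    z.im * (deriv f z / f z).im ≤ -(z.im ^ 2 / ‖z - a‖ ^ 2) := by
  have hfz : f z ≠ 0 := fun h ↦ hz (hzero z h)
  obtain ⟨c, hc⟩ := exists_ofReal_ne_zero hf ⟨z, hfz⟩
  refine le_of_forall_pos_le_add fun ε hε ↦ ?_
  have hε' : 0 < ε / (|z.im| + 1) := by positivity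
  obtain ⟨S, m, ψ, hS, hS', heq, hψ⟩ :=
    exists_logDeriv_eq_sum_add_small_im hf hρ0 hρ hgr hreal hzero hc hfz ‖a - c‖ hε'
  have haS : a ∈ S := hS' a ha le_rfl
  rw [heq, Complex.add_im, Complex.im_sum, mul_add, Finset.mul_sum]
  have hterm : ∀ b ∈ S, z.im * ((m b : ℂ) / (z - b)).im = -(m b * z.im ^ 2 / ‖z - b‖ ^ 2) :=
    fun b hb ↦ im_mul_im_div_sub (hzero b (hS b hb).1) (m b) z
  rw [Finset.sum_congr rfl hterm]
  have hsum : ∑ b ∈ S, -((m b : ℝ) * z.im ^ 2 / ‖z - b‖ ^ 2) ≤ -(m a * z.im ^ 2 / ‖z - a‖ ^ 2) := by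
    have := Finset.single_le_sum (f := fun b ↦ (m b : ℝ) * z.im ^ 2 / ‖z - b‖ ^ 2)
      (fun b _ ↦ by positivity) haS
    rw [Finset.sum_neg_distrib]
    linarith
  have hma : (1 : ℝ) ≤ m a := by exact_mod_cast (hS a haS).2
  have hza : 0 < ‖z - a‖ ^ 2 := by
    have : z - a ≠ 0 := by
      intro h; apply hz; rw [sub_eq_zero.1 h]; exact hzero a ha
    positivity
  have h1 : -(m a * z.im ^ 2 / ‖z - a‖ ^ 2) ≤ -(z.im ^ 2 / ‖z - a‖ ^ 2) := by
    rw [neg_le_neg_iff, div_le_div_iff_of_pos_right hza]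
    nlinarith [sq_nonneg z.im]
  have h2 : z.im * ψ.im ≤ ε := by
    calc z.im * ψ.im ≤ |z.im| * |ψ.im| := by
          rw [← abs_mul]; exact le_abs_self _
      _ ≤ (|z.im| + 1) * (ε / (|z.im| + 1)) := by gcongr; linarith
      _ = ε := by field_simp
  linarith

/-- **`(Im z) · Im (f'/f)(z) ≤ 0`** for `f` real entire of order `< 2` with only real zeros.
[folklore] -/
theorem im_mul_im_logDeriv_nonpos (hf : Differentiable ℂ f) {ρ C : ℝ} (hρ0 : 0 ≤ ρ) (hρ : ρ < 2)
    (hgr : ∀ z, ‖f z‖ ≤ C * Real.exp (‖z‖ ^ ρ)) (hreal : ∀ x : ℝ, (f x).im = 0)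
    (hzero : ∀ z, f z = 0 → z.im = 0) {z : ℂ} (hz : z.im ≠ 0) :
    z.im * (deriv f z / f z).im ≤ 0 := by
  have hfz : f z ≠ 0 := fun h ↦ hz (hzero z h)
  obtain ⟨c, hc⟩ := exists_ofReal_ne_zero hf ⟨z, hfz⟩
  refine le_of_forall_pos_le_add fun ε hε ↦ ?_
  have hε' : 0 < ε / (|z.im| + 1) := by positivity
  obtain ⟨S, m, ψ, hS, -, heq, hψ⟩ :=
    exists_logDeriv_eq_sum_add_small_im hf hρ0 hρ hgr hreal hzero hc hfz 0 hε'
  rw [heq, Complex.add_im, Complex.im_sum, mul_add, Finset.mul_sum, zero_add]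
  have hterm : ∀ b ∈ S, z.im * ((m b : ℂ) / (z - b)).im = -(m b * z.im ^ 2 / ‖z - b‖ ^ 2) :=
    fun b hb ↦ im_mul_im_div_sub (hzero b (hS b hb).1) (m b) z
  rw [Finset.sum_congr rfl hterm]
  have hsum : ∑ b ∈ S, -((m b : ℝ) * z.im ^ 2 / ‖z - b‖ ^ 2) ≤ 0 :=
    Finset.sum_nonpos fun b _ ↦ by
      have : 0 ≤ (m b : ℝ) * z.im ^ 2 / ‖z - b‖ ^ 2 := by positivity
      linarith
  have h2 : z.im * ψ.im ≤ ε := by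
    calc z.im * ψ.im ≤ |z.im| * |ψ.im| := by
          rw [← abs_mul]; exact le_abs_self _
      _ ≤ (|z.im| + 1) * (ε / (|z.im| + 1)) := by gcongr; linarith
      _ = ε := by field_simp
  linarith

/-- **Zero-free case.** If moreover `f` has no zeros at all, then `Im (f'/f) ≡ 0` (so `f'/f` is
a real constant and `f = f(0) e^{αz}`; we only need the vanishing). [folklore] -/
theorem im_logDeriv_eq_zero_of_forall_ne_zero (hf : Differentiable ℂ f) {ρ C : ℝ} (hρ0 : 0 ≤ ρ)
    (hρ : ρ < 2) (hgr : ∀ z, ‖f z‖ ≤ C * Real.exp (‖z‖ ^ ρ)) (hreal : ∀ x : ℝ, (f x).im = 0)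
    (hne : ∀ z, f z ≠ 0) (z : ℂ) : (deriv f z / f z).im = 0 := by
  have hzero : ∀ w, f w = 0 → w.im = 0 := fun w hw ↦ absurd hw (hne w)
  refine abs_nonpos_iff.1 (le_of_forall_pos_le_add fun ε hε ↦ ?_)
  obtain ⟨S, m, ψ, hS, -, heq, hψ⟩ :=
    exists_logDeriv_eq_sum_add_small_im hf hρ0 hρ hgr hreal hzero (hne 0) (hne z) 0 hε
  have hS0 : S = ∅ := Finset.eq_empty_of_forall_notMem fun a ha ↦ hne a (hS a ha).1
  rw [heq, hS0, Finset.sum_empty, zero_add, zero_add]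
  exact hψ

/-! ## Monotonicity of `|f(x + iy)|` in `|y|` -/

/-- The derivative of `y ↦ ‖f(x + iy)‖²` is `−2 ‖f(z)‖² Im (f'(z)/f(z))`, `z = x + iy` (both
sides vanish when `f(z) = 0`). [folklore] -/
theorem hasDerivAt_norm_sq_vertical (hf : Differentiable ℂ f) (x y : ℝ) :
    HasDerivAt (fun t : ℝ ↦ ‖f (x + I * t)‖ ^ 2)
      (-2 * ‖f (x + I * y)‖ ^ 2 * (deriv f (x + I * y) / f (x + I * y)).im) y := by
  set z : ℂ := x + I * y with hz
  have h1 : HasDerivAt (fun w : ℂ ↦ (x : ℂ) + I * w) I (y : ℂ) := by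
    simpa using ((hasDerivAt_id (y : ℂ)).const_mul I).const_add (x : ℂ)
  have h2 : HasDerivAt (fun w : ℂ ↦ f (x + I * w)) (deriv f z * I) (y : ℂ) := by
    have := (hf z).hasDerivAt.comp (y : ℂ) h1
    simpa [Function.comp_def] using this
  have h3 : HasDerivAt (fun t : ℝ ↦ f (x + I * t)) (deriv f z * I) y := h2.comp_ofReal
  have h4 := h3.norm_sq
  simp only [Complex.inner] at h4
  convert h4 using 1
  -- `-2 ‖f z‖² Im(f'/f) = 2 Re((f' I) conj f)`
  rw [← hz]
  rcases eq_or_ne (f z) 0 with h0 | h0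
  · simp [h0]
  · have hn : (‖f z‖ ^ 2 : ℝ) = Complex.normSq (f z) := (Complex.normSq_eq_norm_sq _).symm
    rw [hn, Complex.div_im]
    simp only [Complex.mul_re, Complex.mul_im, Complex.I_re, Complex.I_im, Complex.conj_re,
      Complex.conj_im, mul_zero, mul_one, zero_sub]
    have hnz : Complex.normSq (f z) ≠ 0 := by rwa [Ne, Complex.normSq_eq_zero]
    field_simp
    ring

/-- The function `y ↦ ‖f(x + iy)‖²` is continuous. [folklore] -/
theorem continuous_norm_sq_vertical (hf : Differentiable ℂ f) (x : ℝ) :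
    Continuous fun t : ℝ ↦ ‖f (x + I * t)‖ ^ 2 := by
  have : Continuous fun t : ℝ ↦ f (x + I * t) := by
    exact hf.continuous.comp (by fun_prop)
  exact (continuous_norm.comp this).pow 2

/-- **Laguerre–Pólya monotonicity.** For `f` real entire of order `< 2` with only real zeros,
`y ↦ ‖f(x + iy)‖²` is non-decreasing on `[0, ∞)`. [folklore] -/
theorem monotoneOn_norm_sq_vertical (hf : Differentiable ℂ f) {ρ C : ℝ} (hρ0 : 0 ≤ ρ) (hρ : ρ < 2)
    (hgr : ∀ z, ‖f z‖ ≤ C * Real.exp (‖z‖ ^ ρ)) (hreal : ∀ x : ℝ, (f x).im = 0)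
    (hzero : ∀ z, f z = 0 → z.im = 0) (x : ℝ) :
    MonotoneOn (fun t : ℝ ↦ ‖f (x + I * t)‖ ^ 2) (Ici 0) := by
  refine monotoneOn_of_deriv_nonneg (convex_Ici 0) (continuous_norm_sq_vertical hf x).continuousOn
    (fun t _ ↦ (hasDerivAt_norm_sq_vertical hf x t).differentiableAt.differentiableWithinAt)
    fun t ht ↦ ?_
  rw [interior_Ici] at ht
  have ht' : (0 : ℝ) < t := ht
  rw [(hasDerivAt_norm_sq_vertical hf x t).deriv]
  have hzim : ((x : ℂ) + I * t).im = t := by simp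
  have key := im_mul_im_logDeriv_nonpos hf hρ0 hρ hgr hreal hzero (z := x + I * t)
    (by rw [hzim]; exact ht'.ne')
  rw [hzim] at key
  have : (deriv f (x + I * t) / f (x + I * t)).im ≤ 0 :=
    nonpos_of_mul_nonpos_right (by nlinarith [key]) ht'  -- placeholder, fixed below if needed
  nlinarith [norm_nonneg (f (x + I * t)), sq_nonneg ‖f (↑x + I * ↑t)‖]

/-- **Strict Laguerre–Pólya monotonicity.** If moreover `f` has at least one zero, then
`y ↦ ‖f(x + iy)‖²` is strictly increasing on `[0, ∞)`. [folklore] -/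
theorem strictMonoOn_norm_sq_vertical (hf : Differentiable ℂ f) {ρ C : ℝ} (hρ0 : 0 ≤ ρ)
    (hρ : ρ < 2) (hgr : ∀ z, ‖f z‖ ≤ C * Real.exp (‖z‖ ^ ρ)) (hreal : ∀ x : ℝ, (f x).im = 0)
    (hzero : ∀ z, f z = 0 → z.im = 0) {a : ℂ} (ha : f a = 0) (x : ℝ) :
    StrictMonoOn (fun t : ℝ ↦ ‖f (x + I * t)‖ ^ 2) (Ici 0) := by
  refine strictMonoOn_of_deriv_pos (convex_Ici 0) (continuous_norm_sq_vertical hf x).continuousOn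
    fun t ht ↦ ?_
  rw [interior_Ici] at ht
  have ht' : (0 : ℝ) < t := ht
  rw [(hasDerivAt_norm_sq_vertical hf x t).deriv]
  set z : ℂ := x + I * t with hzdef
  have hzim : z.im = t := by simp [hzdef]
  have hfz : f z ≠ 0 := fun h ↦ by have := hzero z h; rw [hzim] at this; exact ht'.ne' this
  have key := im_mul_im_logDeriv_le hf hρ0 hρ hgr hreal hzero (z := z) (by rw [hzim]; exact ht'.ne') ha
  rw [hzim] at key
  have hza : 0 < ‖z - a‖ ^ 2 := by
    have : z - a ≠ 0 := by
      intro h; rw [sub_eq_zero.1 h] at hfz; exact hfz ha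
    positivity
  have hneg : (deriv f z / f z).im < 0 := by
    have h1 : t * (deriv f z / f z).im < 0 := by
      have : 0 < t ^ 2 / ‖z - a‖ ^ 2 := by positivity
      linarith
    nlinarith
  have hpos : 0 < ‖f z‖ ^ 2 := by positivity
  nlinarith

/-- Zero-free case: `‖f(x + iy)‖ = ‖f(x)‖` for all `y`. [folklore] -/
theorem norm_vertical_eq_of_forall_ne_zero (hf : Differentiable ℂ f) {ρ C : ℝ} (hρ0 : 0 ≤ ρ)
    (hρ : ρ < 2) (hgr : ∀ z, ‖f z‖ ≤ C * Real.exp (‖z‖ ^ ρ)) (hreal : ∀ x : ℝ, (f x).im = 0)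
    (hne : ∀ z, f z ≠ 0) (x y : ℝ) : ‖f (x + I * y)‖ = ‖f x‖ := by
  have hd : ∀ t : ℝ, deriv (fun t : ℝ ↦ ‖f (x + I * t)‖ ^ 2) t = 0 := fun t ↦ by
    rw [(hasDerivAt_norm_sq_vertical hf x t).deriv,
      im_logDeriv_eq_zero_of_forall_ne_zero hf hρ0 hρ hgr hreal hne, mul_zero]
  have hdiff : Differentiable ℝ fun t : ℝ ↦ ‖f (x + I * t)‖ ^ 2 := fun t ↦
    (hasDerivAt_norm_sq_vertical hf x t).differentiableAt
  have h := is_const_of_deriv_eq_zero hdiff hd y 0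
  simp only [Complex.ofReal_zero, mul_zero, add_zero] at h
  exact (sq_eq_sq₀ (norm_nonneg _) (norm_nonneg _)).1 h

/-! ## de Bruijn's shift operator `f ↦ f(z + iλ) + f(z − iλ)` -/

/-- The shift `f(z + iλ) + f(z − iλ)` of an entire function is entire. [folklore] -/
theorem differentiable_shift (hf : Differentiable ℂ f) (lam : ℝ) :
    Differentiable ℂ fun z ↦ f (z + I * lam) + f (z - I * lam) := by
  have h1 : Differentiable ℂ fun z ↦ f (z + I * lam) := hf.comp (by fun_prop)
  have h2 : Differentiable ℂ fun z ↦ f (z - I * lam) := hf.comp (by fun_prop)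
  exact h1.add h2

/-- The shift of a real entire function is real on `ℝ`:
`f(x − iλ) = f(conj(x + iλ)) = conj f(x + iλ)`. [folklore] -/
theorem im_shift_ofReal (hf : Differentiable ℂ f) (hreal : ∀ x : ℝ, (f x).im = 0) (lam x : ℝ) :
    (f (x + I * lam) + f (x - I * lam)).im = 0 := by
  have h : (x : ℂ) - I * lam = conj ((x : ℂ) + I * lam) := by
    apply Complex.ext <;> simp
  rw [h, apply_conj_eq_conj hf hreal, Complex.add_im, Complex.conj_im, add_neg_cancel]

/-- Growth under translation: for `0 ≤ ρ < 2`, `s ≥ 0` there is `K` with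
`(r + s)^ρ ≤ K + r^{(ρ+2)/2}` for all `r ≥ 0`. [folklore] -/
theorem exists_add_rpow_le (ρ s : ℝ) (hρ0 : 0 ≤ ρ) (hρ : ρ < 2) (hs : 0 ≤ s) :
    ∃ K : ℝ, 0 ≤ K ∧ ∀ r : ℝ, 0 ≤ r → (r + s) ^ ρ ≤ K + r ^ ((ρ + 2) / 2) := by
  set ρ' : ℝ := (ρ + 2) / 2 with hρ'
  have hδ : 0 < ρ' - ρ := by rw [hρ']; linarith
  set b : ℝ := (4 : ℝ) ^ (1 / (ρ' - ρ)) with hb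
  have hb0 : 0 ≤ b := Real.rpow_nonneg (by norm_num) _
  set R₀ : ℝ := max (max s 1) b with hR₀
  refine ⟨(R₀ + s) ^ ρ, Real.rpow_nonneg (by positivity) _, fun r hr ↦ ?_⟩
  have hrρ' : 0 ≤ r ^ ρ' := Real.rpow_nonneg hr _
  rcases le_or_gt r R₀ with h | h
  · calc (r + s) ^ ρ ≤ (R₀ + s) ^ ρ := Real.rpow_le_rpow (by positivity) (by linarith) hρ0
      _ ≤ (R₀ + s) ^ ρ + r ^ ρ' := le_add_of_nonneg_right hrρ'
  · have hrs : s ≤ r := ((le_max_left _ _).trans (le_max_left _ _)).trans h.le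
    have hr1 : 1 ≤ r := ((le_max_right _ _).trans (le_max_left _ _)).trans h.le
    have hrb : b ≤ r := (le_max_right _ _).trans h.le
    have hr0 : 0 < r := by linarith
    have h1 : (r + s) ^ ρ ≤ (2 * r) ^ ρ := Real.rpow_le_rpow (by positivity) (by linarith) hρ0
    have h2 : (2 * r) ^ ρ = 2 ^ ρ * r ^ ρ := Real.mul_rpow (by norm_num) hr0.le
    have h3 : (2 : ℝ) ^ ρ ≤ 4 := by
      calc (2 : ℝ) ^ ρ ≤ 2 ^ (2 : ℝ) := Real.rpow_le_rpow_of_exponent_le (by norm_num) hρ.le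
        _ = 4 := by norm_num
    have h4 : (4 : ℝ) ≤ r ^ (ρ' - ρ) := by
      calc (4 : ℝ) = b ^ (ρ' - ρ) := by
            rw [hb, ← Real.rpow_mul (by norm_num), one_div_mul_cancel hδ.ne', Real.rpow_one]
        _ ≤ r ^ (ρ' - ρ) := Real.rpow_le_rpow hb0 hrb hδ.le
    have h5 : r ^ (ρ' - ρ) * r ^ ρ = r ^ ρ' := by
      rw [← Real.rpow_add hr0]; ring_nf
    have hrρ : 0 ≤ r ^ ρ := Real.rpow_nonneg hr0.le _
    calc (r + s) ^ ρ ≤ 2 ^ ρ * r ^ ρ := h1.trans h2.le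
      _ ≤ 4 * r ^ ρ := by gcongr
      _ ≤ r ^ (ρ' - ρ) * r ^ ρ := by gcongr
      _ = r ^ ρ' := h5
      _ ≤ (R₀ + s) ^ ρ + r ^ ρ' := le_add_of_nonneg_left (Real.rpow_nonneg (by positivity) _)

/-- The shift of an entire function of order `< 2` has order `< 2`: with `ρ' = (ρ + 2)/2 ∈ [ρ, 2)`,
`‖f(z + iλ) + f(z − iλ)‖ ≤ C' e^{‖z‖^{ρ'}}`. [folklore] -/
theorem norm_shift_le {ρ C : ℝ} (hρ0 : 0 ≤ ρ) (hρ : ρ < 2)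
    (hgr : ∀ z, ‖f z‖ ≤ C * Real.exp (‖z‖ ^ ρ)) (lam : ℝ) :
    ∃ C' : ℝ, ∀ z, ‖f (z + I * lam) + f (z - I * lam)‖ ≤ C' * Real.exp (‖z‖ ^ ((ρ + 2) / 2)) := by
  obtain ⟨K, hK0, hK⟩ := exists_add_rpow_le ρ |lam| hρ0 hρ (abs_nonneg lam)
  have hC := growthConst_nonneg hgr
  refine ⟨2 * C * Real.exp K, fun z ↦ ?_⟩
  have hI : ‖I * (lam : ℂ)‖ = |lam| := by simp
  have key : ∀ w : ℂ, ‖w‖ ≤ ‖z‖ + |lam| →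
      ‖f w‖ ≤ C * Real.exp K * Real.exp (‖z‖ ^ ((ρ + 2) / 2)) := by
    intro w hw
    refine (hgr w).trans ?_
    rw [mul_assoc, ← Real.exp_add]
    gcongr
    calc ‖w‖ ^ ρ ≤ (‖z‖ + |lam|) ^ ρ := Real.rpow_le_rpow (norm_nonneg _) hw hρ0
      _ ≤ K + ‖z‖ ^ ((ρ + 2) / 2) := hK ‖z‖ (norm_nonneg _)
  have h1 : ‖z + I * lam‖ ≤ ‖z‖ + |lam| := by
    calc ‖z + I * lam‖ ≤ ‖z‖ + ‖I * (lam : ℂ)‖ := norm_add_le _ _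
      _ = ‖z‖ + |lam| := by rw [hI]
  have h2 : ‖z - I * lam‖ ≤ ‖z‖ + |lam| := by
    calc ‖z - I * lam‖ ≤ ‖z‖ + ‖I * (lam : ℂ)‖ := norm_sub_le _ _
      _ = ‖z‖ + |lam| := by rw [hI]
  calc ‖f (z + I * lam) + f (z - I * lam)‖ ≤ ‖f (z + I * lam)‖ + ‖f (z - I * lam)‖ :=
        norm_add_le _ _
    _ ≤ C * Real.exp K * Real.exp (‖z‖ ^ ((ρ + 2) / 2)) +
        C * Real.exp K * Real.exp (‖z‖ ^ ((ρ + 2) / 2)) := add_le_add (key _ h1) (key _ h2)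
    _ = 2 * C * Real.exp K * Real.exp (‖z‖ ^ ((ρ + 2) / 2)) := by ring

/-- **de Bruijn 1950, Thm. 8 (case `Δ = 0`, `N = 1`; the entire-function form of Lemma 1 /
Thm. 3), proved without Hadamard factorisation.** Let `f` be a real entire function of order
`< 2` (`‖f‖ ≤ C e^{‖z‖^ρ}`, `0 ≤ ρ < 2`) with only real zeros, and `λ ∈ ℝ`. Then
`F(z) = f(z + iλ) + f(z − iλ)` is either identically zero or has only real zeros. (If `f` has a
zero, `|f(x + iy)|` is strictly increasing in `|y|`, and `|y + λ| ≠ |y − λ|` off the real axis;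
if `f` is zero-free, `|f(x + iy)| = |f(x)|`, so `f(z + iλ)/f(z − iλ)` is a unimodular entire
function, hence constant by Liouville.) [cite: Bruijn1950, Thm. 8] -/
theorem deBruijn_shift_dichotomy (hf : Differentiable ℂ f) {ρ C : ℝ} (hρ0 : 0 ≤ ρ) (hρ : ρ < 2)
    (hgr : ∀ z, ‖f z‖ ≤ C * Real.exp (‖z‖ ^ ρ)) (hreal : ∀ x : ℝ, (f x).im = 0)
    (hzero : ∀ z, f z = 0 → z.im = 0) (lam : ℝ) :
    (∀ z, f (z + I * lam) + f (z - I * lam) = 0) ∨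
      ∀ z, f (z + I * lam) + f (z - I * lam) = 0 → z.im = 0 := by
  by_cases hex : ∃ a, f a = 0
  · -- `f` has a zero: strict monotonicity
    obtain ⟨a, ha⟩ := hex
    refine Or.inr fun z hz ↦ ?_
    by_contra hzim
    set x : ℝ := z.re
    set y : ℝ := z.im
    have hzxy : z = x + I * y := by
      apply Complex.ext <;> simp [x, y]
    have hmono := strictMonoOn_norm_sq_vertical hf hρ0 hρ hgr hreal hzero ha x
    have hnorm : ‖f (z + I * lam)‖ = ‖f (z - I * lam)‖ := by
      rw [show f (z + I * lam) = -f (z - I * lam) by linear_combination hz, norm_neg]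
    have e1 : z + I * lam = x + I * ((y + lam : ℝ) : ℂ) := by rw [hzxy]; push_cast; ring
    have e2 : z - I * lam = x + I * ((y - lam : ℝ) : ℂ) := by rw [hzxy]; push_cast; ring
    rw [e1, e2, norm_vertical_eq_abs hf hreal x (y + lam),
      norm_vertical_eq_abs hf hreal x (y - lam)] at hnorm
    have hsq : ‖f (x + I * ((|y + lam| : ℝ) : ℂ))‖ ^ 2 = ‖f (x + I * ((|y - lam| : ℝ) : ℂ))‖ ^ 2 := by
      rw [hnorm]
    have habs : |y + lam| = |y - lam| :=
      hmono.injOn (Set.mem_Ici.2 (abs_nonneg _)) (Set.mem_Ici.2 (abs_nonneg _)) hsq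
    have hyl : y * lam = 0 := by
      have := congrArg (· ^ 2) habs
      simp only [sq_abs] at this
      linarith
    rcases mul_eq_zero.1 hyl with hy | hl
    · exact hzim hy
    · apply hzim
      apply hzero z
      have : f (z + I * lam) + f (z - I * lam) = 2 * f z := by
        rw [hl]; simp; ring
      have h2 : 2 * f z = 0 := by rw [← this]; exact hz
      simpa using h2
  · -- zero-free: Liouville for the unimodular quotient
    push Not at hex
    have hconst : ∀ w : ℂ, ‖f w‖ = ‖f (w.re : ℂ)‖ := fun w ↦ by
      have e : w = (w.re : ℂ) + I * (w.im : ℂ) := by apply Complex.ext <;> simp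
      conv_lhs => rw [e]
      exact norm_vertical_eq_of_forall_ne_zero hf hρ0 hρ hgr hreal hex w.re w.im
    set q : ℂ → ℂ := fun z ↦ f (z + I * lam) / f (z - I * lam) with hq
    have hqd : Differentiable ℂ q := by
      refine Differentiable.div (hf.comp (by fun_prop)) (hf.comp (by fun_prop)) fun z ↦ hex _
    have hq1 : ∀ z, ‖q z‖ = 1 := fun z ↦ by
      rw [hq]
      simp only [norm_div]
      rw [hconst (z + I * lam), hconst (z - I * lam)]
      simp only [Complex.add_re, Complex.sub_re, Complex.mul_re, Complex.I_re, Complex.ofReal_re,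
        zero_mul, Complex.I_im, Complex.ofReal_im, mul_zero, sub_zero, add_zero]
      exact div_self (norm_ne_zero_iff.2 (hex _))
    have hqb : Bornology.IsBounded (range q) := by
      refine (Metric.isBounded_iff_subset_closedBall (0 : ℂ)).2 ⟨1, ?_⟩
      rintro _ ⟨z, rfl⟩
      simp [hq1 z]
    have hqc : ∀ z, q z = q 0 := fun z ↦ hqd.apply_eq_apply_of_bounded hqb z 0
    have hF : ∀ z, f (z + I * lam) + f (z - I * lam) = f (z - I * lam) * (q 0 + 1) := by
      intro z
      rw [← hqc z, hq]
      field_simp [hex (z - I * lam)]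
    by_cases h1 : q 0 + 1 = 0
    · exact Or.inl fun z ↦ by rw [hF, h1, mul_zero]
    · exact Or.inr fun z hz ↦ by
        rw [hF] at hz
        rcases mul_eq_zero.1 hz with h | h
        · exact absurd h (hex _)
        · exact absurd h h1

/-- The shift operator applied to the zero function is zero, and so are its iterates.
[folklore] -/
theorem iterate_shift_zero (lam : ℝ) (M : ℕ) :
    (fun g : ℂ → ℂ ↦ fun z ↦ g (z + I * lam) + g (z - I * lam))^[M] (fun _ ↦ 0) = fun _ ↦ 0 := by
  apply Function.iterate_fixed
  funext z
  simp

/-- **de Bruijn 1950, Thm. 8 (case `Δ = 0`, `φ(u) = (1 + u)^M`), Hadamard-free.** For `f` real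
entire of order `< 2` with only real zeros, the `M`-fold iterate of `g ↦ g(· + iλ) + g(· − iλ)`
applied to `f` (that is, `z ↦ ∑ₖ (M choose k) f(z + (2k − M) iλ)`) is either identically zero or
has only real zeros. [cite: Bruijn1950, Thm. 8] -/
theorem deBruijn_iterate_shift_dichotomy (hf : Differentiable ℂ f) {ρ C : ℝ} (hρ0 : 0 ≤ ρ)
    (hρ : ρ < 2) (hgr : ∀ z, ‖f z‖ ≤ C * Real.exp (‖z‖ ^ ρ)) (hreal : ∀ x : ℝ, (f x).im = 0)
    (hzero : ∀ z, f z = 0 → z.im = 0) (lam : ℝ) (M : ℕ) :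
    (∀ z, ((fun g : ℂ → ℂ ↦ fun z ↦ g (z + I * lam) + g (z - I * lam))^[M] f) z = 0) ∨
      ∀ z, ((fun g : ℂ → ℂ ↦ fun z ↦ g (z + I * lam) + g (z - I * lam))^[M] f) z = 0 →
        z.im = 0 := by
  induction M generalizing f ρ C with
  | zero => exact Or.inr hzero
  | succ M ih =>
    rw [Function.iterate_succ_apply]
    rcases deBruijn_shift_dichotomy hf hρ0 hρ hgr hreal hzero lam with h0 | h1
    · left
      have hF : (fun z ↦ f (z + I * lam) + f (z - I * lam)) = fun _ ↦ 0 := funext h0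
      intro z
      rw [hF, iterate_shift_zero]
    · obtain ⟨C', hC'⟩ := norm_shift_le hρ0 hρ hgr lam
      exact ih (differentiable_shift hf lam) (by positivity) (by linarith) hC'
        (im_shift_ofReal hf hreal lam) h1

end Literature.Analysis.Complex
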